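import Summits.Ventures.Crystal3D.Theorems.StickyWulffConstantGenericWallFloorStackLedgerLocalStar
import Summits.Ventures.Crystal3D.Theorems.StickyWulffConstantGenericWallFloorAffineSampleDeficit
import Summits.Ventures.Crystal3D.Theorems.StickyWulffConstantGenericWallFloorSlotGeometry
import Summits.Ventures.Crystal3D.Theses.StickyWulffConstant
import Summits.Ventures.Crystal3D.StickySpheres.FinsetBridge
import HarnessLib

/-!
# `GenericWallFloor` PER PAIR from a residual-free stack ledger: the crux's conclusion verbatim for every
# non-chain, ray-separated or word-criterion pair (crux `GenericWallFloor`, line `WallLedgerG`)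

HONEST FRAMING. Part of the venture `Summits/Ventures/Crystal3D` (cell `crystal3d-full`), helper `--supports` the
crux `GenericWallFloor` (stmt-Ventures-19480) of `route-Ventures-StickyWulffConstant`, registered line `WallLedgerG`,
open stub `stub_twoSlabAdhesion` (general fillings).  The planner's registered skeleton composes the crux from
`stub_affineSampleDeficit` (LANDED, `…AffineSampleDeficit`) and `stub_twoSlabAdhesion` (open) by the split
`D(X) = D(P₁) + D(P₂) + D(Y) − cross − cross`.  This file performs that composition PAIR BY PAIR:

* `GenericWallFloorAt A₁ t₁ A₂ t₂` — the matrix of the route decl `GenericWallFloor` for ONE pair, verbatim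
  (`genericWallFloor_iff_at`: the crux is `∀ pairs, ¬co-axial → GenericWallFloorAt`, by `Iff.rfl`);
* `genericWallFloorAt_of_ledger` — a residual-free FULL-charge ledger for the pair (the common conclusion shape of
  `twoSlabAdhesion_stackLedger_local'/_local_chain/_local_word`, any steep slots: charge `½(κ₁+κ₂) ≥ 1`) plus
  the landed `stub_affineSampleDeficit` give `GenericWallFloorAt` (the skeleton's composition, localised);
* hence, modulo EXACTLY the two admissible named inputs `ExactOnly`(C12-55) [E1] and `StarPairCoaxial`
  [certified as `StarPairFar`] (`…StackLedgerLocalStar`): **`genericWallFloorAt_nonChain_of_star`** (every pair with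
  a mirror-closed family `𝓕 ∋ A₁` avoiding `A₂·Λ₀`; steep slots chosen inside by `exists_steep_slot`),
  **`genericWallFloorAt_chain_of_star`** (every pair with steep slots whose `chainFrames` are separated),
  **`genericWallFloorAt_word_of_star`** (every chain pair under the word criterion).

So `GenericWallFloor`'s conclusion holds verbatim, at `c₀ = 1`, for every pair outside the RAY-ALIGNED chain core
(ROUTE.md §84(3)(b), R41t), conditional on the two computations.  WHAT THIS IS NOT: not the crux (the ray-aligned
core and the two named inputs remain); rung credit only; F-C1 not moved.
-/

noncomputable section

namespace Summit.Ventures.Crystal3D.Theorems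

open Summit.Ventures.Crystal3D Finset
open Summit.Ventures.Crystal3D.Cruxes.GenericWallFloor.WallLedgerG (AffineSampleDeficit)
open Literature.MathematicalPhysics.StatisticalMechanics (fccStacking barlowStacking IsHaggSeq contactDeficiency)
open scoped InnerProductSpace

/-- **`GenericWallFloor` at one pair**: the matrix of the route decl
`Summit.Ventures.Crystal3D.Theses.StickyWulffConstant.GenericWallFloor` for the pair `(A₁, t₁; A₂, t₂)`, verbatim. -/
def GenericWallFloorAt (A₁ : EuclideanSpace ℝ (Fin 3) ≃ₗᵢ[ℝ] EuclideanSpace ℝ (Fin 3)) (t₁ : EuclideanSpace ℝ (Fin 3))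
    (A₂ : EuclideanSpace ℝ (Fin 3) ≃ₗᵢ[ℝ] EuclideanSpace ℝ (Fin 3)) (t₂ : EuclideanSpace ℝ (Fin 3)) : Prop :=
  ∃ C R₀ : ℝ, 0 < R₀ ∧ ∀ h : ℝ, 0 ≤ h → ∀ ρ : ℝ, R₀ ≤ ρ → ∀ (N : ℕ) (x : Fin N → EuclideanSpace ℝ (Fin 3)),
    Summit.Ventures.Crystal3D.IsUnitPacking x → (∀ i, -(2 * R₀) ≤ x i 2 ∧ x i 2 ≤ h + 2 * R₀ ∧ x i 0 ^ 2 + x i 1 ^ 2 ≤ ρ ^ 2) →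
    (∀ p ∈ (fun p => A₁ p + t₁) '' fccStacking 1 (Real.sqrt (2 / 3)),
      (-(2 * R₀) ≤ p 2 ∧ p 2 ≤ -R₀ ∧ p 0 ^ 2 + p 1 ^ 2 ≤ ρ ^ 2) → ∃ i, x i = p) →
    (∀ p ∈ (fun p => A₂ p + t₂) '' fccStacking 1 (Real.sqrt (2 / 3)),
      (h + R₀ ≤ p 2 ∧ p 2 ≤ h + 2 * R₀ ∧ p 0 ^ 2 + p 1 ^ 2 ≤ ρ ^ 2) → ∃ i, x i = p) →
    (Real.sqrt 2 / 4 * ∑ᶠ w ∈ {w ∈ fccStacking 1 (Real.sqrt (2 / 3)) | ‖w‖ = 1},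
        |⟪w, A₁.symm (EuclideanSpace.single (2 : Fin 3) (1 : ℝ))⟫_ℝ| +
      Real.sqrt 2 / 4 * ∑ᶠ w ∈ {w ∈ fccStacking 1 (Real.sqrt (2 / 3)) | ‖w‖ = 1},
        |⟪w, A₂.symm (EuclideanSpace.single (2 : Fin 3) (1 : ℝ))⟫_ℝ| + 1) * Real.pi * ρ ^ 2 - C * (1 + h) * ρ ≤
      6 * (N : ℝ) - (Summit.Ventures.Crystal3D.numContacts x : ℝ)

/-- The crux IS «every non-co-axial pair satisfies `GenericWallFloorAt`» (definitional). -/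
theorem genericWallFloor_iff_at :
    Summit.Ventures.Crystal3D.Theses.StickyWulffConstant.GenericWallFloor ↔
      ∀ (A₁ : EuclideanSpace ℝ (Fin 3) ≃ₗᵢ[ℝ] EuclideanSpace ℝ (Fin 3)) (t₁ : EuclideanSpace ℝ (Fin 3))
        (A₂ : EuclideanSpace ℝ (Fin 3) ≃ₗᵢ[ℝ] EuclideanSpace ℝ (Fin 3)) (t₂ : EuclideanSpace ℝ (Fin 3)),
        ¬ (∃ (L : EuclideanSpace ℝ (Fin 3) ≃ₗᵢ[ℝ] EuclideanSpace ℝ (Fin 3)) (s₁ s₂ : EuclideanSpace ℝ (Fin 3))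
            (σ σ' : ℤ → ℤ), IsHaggSeq σ ∧ IsHaggSeq σ' ∧
            (fun p => A₁ p + t₁) '' fccStacking 1 (Real.sqrt (2 / 3)) ⊆
              (fun p => L p + s₁) '' barlowStacking 1 (Real.sqrt (2 / 3)) σ ∧
            (fun p => A₂ p + t₂) '' fccStacking 1 (Real.sqrt (2 / 3)) ⊆
              (fun p => L p + s₂) '' barlowStacking 1 (Real.sqrt (2 / 3)) σ') →
        GenericWallFloorAt A₁ t₁ A₂ t₂ :=
  Iff.rfl

/-- A steep UP slot exists for every frame (from `exists_steep_slot` at `ν = A⁻¹ e₃`). -/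
theorem exists_steep_slot_up (A : EuclideanSpace ℝ (Fin 3) ≃ₗᵢ[ℝ] EuclideanSpace ℝ (Fin 3)) :
    ∃ u ∈ fccSlots, Real.sqrt 2 / 2 ≤ ⟪A u, EuclideanSpace.single (2 : Fin 3) (1 : ℝ)⟫_ℝ := by
  have he : ‖A.symm (EuclideanSpace.single (2 : Fin 3) (1 : ℝ))‖ = 1 := by
    rw [LinearIsometryEquiv.norm_map, PiLp.norm_single, norm_one]
  obtain ⟨w, hw, hw1, hsteep⟩ := exists_steep_slot _ he
  refine ⟨w, mem_fccSlots_of_unit hw hw1, ?_⟩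
  rwa [← LinearIsometryEquiv.inner_map_map A, LinearIsometryEquiv.apply_symm_apply] at hsteep

/-- A steep DOWN slot exists for every frame. -/
theorem exists_steep_slot_down (A : EuclideanSpace ℝ (Fin 3) ≃ₗᵢ[ℝ] EuclideanSpace ℝ (Fin 3)) :
    ∃ u ∈ fccSlots, ⟪A u, EuclideanSpace.single (2 : Fin 3) (1 : ℝ)⟫_ℝ ≤ -(Real.sqrt 2 / 2) := by
  obtain ⟨u, hu, hsteep⟩ := exists_steep_slot_up A
  refine ⟨-u, neg_mem_fccSlots hu, ?_⟩
  rw [map_neg, inner_neg_left]; linarith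

open scoped Classical in
/-- **Per-pair composition of the skeleton.**  A residual-free full-charge two-slab ledger for the pair (steep slots
`u₁` up, `u₂` down; charge `½(√2|⟪A₁u₁,e₃⟫| + √2|⟪A₂u₂,e₃⟫|) ≥ 1`) and the landed `stub_affineSampleDeficit` give
`GenericWallFloorAt` — the planner's `GenericWallFloor_holds_of_stubs`, one pair at a time. -/
theorem genericWallFloorAt_of_ledger
    (A₁ : EuclideanSpace ℝ (Fin 3) ≃ₗᵢ[ℝ] EuclideanSpace ℝ (Fin 3)) (t₁ : EuclideanSpace ℝ (Fin 3))
    (A₂ : EuclideanSpace ℝ (Fin 3) ≃ₗᵢ[ℝ] EuclideanSpace ℝ (Fin 3)) (t₂ : EuclideanSpace ℝ (Fin 3))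
    {u₁ : EuclideanSpace ℝ (Fin 3)} (hsteep₁ : Real.sqrt 2 / 2 ≤ ⟪A₁ u₁, EuclideanSpace.single (2 : Fin 3) (1 : ℝ)⟫_ℝ)
    {u₂ : EuclideanSpace ℝ (Fin 3)} (hsteep₂ : ⟪A₂ u₂, EuclideanSpace.single (2 : Fin 3) (1 : ℝ)⟫_ℝ ≤ -(Real.sqrt 2 / 2))
    (hled : ∃ C R₀ : ℝ, 1 ≤ R₀ ∧ ∀ h : ℝ, 0 ≤ h → ∀ ρ : ℝ, R₀ ≤ ρ →
      ∀ X P₁ P₂ : Finset (EuclideanSpace ℝ (Fin 3)),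
      (∀ p ∈ X, ∀ q ∈ X, p ≠ q → 1 ≤ dist p q) → P₁ ⊆ X → P₂ ⊆ X \ P₁ →
      (∀ p ∈ X, -(2 * R₀) ≤ p 2 ∧ p 2 ≤ h + 2 * R₀ ∧ p 0 ^ 2 + p 1 ^ 2 ≤ ρ ^ 2) →
      (∀ p, p ∈ P₁ ↔ (p ∈ (fun q => A₁ q + t₁) '' fccStacking 1 (Real.sqrt (2 / 3)) ∧
        -(2 * R₀) ≤ p 2 ∧ p 2 ≤ -R₀ ∧ p 0 ^ 2 + p 1 ^ 2 ≤ ρ ^ 2)) →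
      (∀ p, p ∈ P₂ ↔ (p ∈ (fun q => A₂ q + t₂) '' fccStacking 1 (Real.sqrt (2 / 3)) ∧
        h + R₀ ≤ p 2 ∧ p 2 ≤ h + 2 * R₀ ∧ p 0 ^ 2 + p 1 ^ 2 ≤ ρ ^ 2)) →
      ((((P₁ ×ˢ (X \ P₁)).filter fun pq => dist pq.1 pq.2 = 1).card : ℕ) : ℝ) +
        ((((P₂ ×ˢ ((X \ P₁) \ P₂)).filter fun pq => dist pq.1 pq.2 = 1).card : ℕ) : ℝ) ≤
        contactDeficiency ((X \ P₁) \ P₂) +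
          (Real.sqrt 2 / 4 * ∑ᶠ w ∈ {w ∈ fccStacking 1 (Real.sqrt (2 / 3)) | ‖w‖ = 1},
              |⟪w, A₁.symm (EuclideanSpace.single (2 : Fin 3) (1 : ℝ))⟫_ℝ| +
            Real.sqrt 2 / 4 * ∑ᶠ w ∈ {w ∈ fccStacking 1 (Real.sqrt (2 / 3)) | ‖w‖ = 1},
              |⟪w, A₂.symm (EuclideanSpace.single (2 : Fin 3) (1 : ℝ))⟫_ℝ| -
            (Real.sqrt 2 * |⟪A₁ u₁, EuclideanSpace.single (2 : Fin 3) (1 : ℝ)⟫_ℝ| +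
              Real.sqrt 2 * |⟪A₂ u₂, EuclideanSpace.single (2 : Fin 3) (1 : ℝ)⟫_ℝ|) / 2) * Real.pi * ρ ^ 2 +
          C * (1 + h) * ρ) :
    GenericWallFloorAt A₁ t₁ A₂ t₂ := by
  classical
  have hS : AffineSampleDeficit := stub_affineSampleDeficit
  obtain ⟨C, R₀, hR₀, hadh⟩ := hled
  obtain ⟨C₁, hC₁⟩ := hS A₁ t₁ R₀ hR₀
  obtain ⟨C₂, hC₂⟩ := hS A₂ t₂ R₀ hR₀
  refine ⟨|C| + |C₁| + |C₂|, R₀, by linarith, ?_⟩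
  intro h hh ρ hρ N x hx hcyl hslab₁ hslab₂
  set φ₁ : ℝ := Real.sqrt 2 / 4 * ∑ᶠ w ∈ {w ∈ fccStacking 1 (Real.sqrt (2 / 3)) | ‖w‖ = 1},
      |⟪w, A₁.symm (EuclideanSpace.single (2 : Fin 3) (1 : ℝ))⟫_ℝ| with hφ₁
  set φ₂ : ℝ := Real.sqrt 2 / 4 * ∑ᶠ w ∈ {w ∈ fccStacking 1 (Real.sqrt (2 / 3)) | ‖w‖ = 1},
      |⟪w, A₂.symm (EuclideanSpace.single (2 : Fin 3) (1 : ℝ))⟫_ℝ| with hφ₂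
  -- the charge: `½(κ₁ + κ₂) ≥ 1` at steep slots
  set κ₁ : ℝ := Real.sqrt 2 * |⟪A₁ u₁, EuclideanSpace.single (2 : Fin 3) (1 : ℝ)⟫_ℝ| with hκ₁
  set κ₂ : ℝ := Real.sqrt 2 * |⟪A₂ u₂, EuclideanSpace.single (2 : Fin 3) (1 : ℝ)⟫_ℝ| with hκ₂
  have hs2 : Real.sqrt 2 * (Real.sqrt 2 / 2) = 1 := by
    rw [← mul_div_assoc, Real.mul_self_sqrt (by norm_num : (0 : ℝ) ≤ 2)]; norm_num
  have hsq0 : 0 ≤ Real.sqrt 2 := Real.sqrt_nonneg 2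
  have hκ₁1 : 1 ≤ κ₁ := by
    have h1 : Real.sqrt 2 / 2 ≤ |⟪A₁ u₁, EuclideanSpace.single (2 : Fin 3) (1 : ℝ)⟫_ℝ| := le_trans hsteep₁ (le_abs_self _)
    calc (1 : ℝ) = Real.sqrt 2 * (Real.sqrt 2 / 2) := hs2.symm
      _ ≤ κ₁ := mul_le_mul_of_nonneg_left h1 hsq0
  have hκ₂1 : 1 ≤ κ₂ := by
    have h1 : Real.sqrt 2 / 2 ≤ |⟪A₂ u₂, EuclideanSpace.single (2 : Fin 3) (1 : ℝ)⟫_ℝ| := by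
      rw [abs_of_nonpos (by linarith only [hsteep₂, Real.sqrt_nonneg 2] :
        ⟪A₂ u₂, EuclideanSpace.single (2 : Fin 3) (1 : ℝ)⟫_ℝ ≤ 0)]
      linarith only [hsteep₂]
    calc (1 : ℝ) = Real.sqrt 2 * (Real.sqrt 2 / 2) := hs2.symm
      _ ≤ κ₂ := mul_le_mul_of_nonneg_left h1 hsq0
  -- the packing as a finite set, the two samples as filters
  have hxinj : Function.Injective x := hx.injective
  set X : Finset (EuclideanSpace ℝ (Fin 3)) := univ.image x with hX
  set P₁ : Finset (EuclideanSpace ℝ (Fin 3)) := X.filter fun p =>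
    p ∈ (fun q => A₁ q + t₁) '' fccStacking 1 (Real.sqrt (2 / 3)) ∧
      -(2 * R₀) ≤ p 2 ∧ p 2 ≤ -R₀ ∧ p 0 ^ 2 + p 1 ^ 2 ≤ ρ ^ 2 with hP₁
  set P₂ : Finset (EuclideanSpace ℝ (Fin 3)) := (X \ P₁).filter fun p =>
    p ∈ (fun q => A₂ q + t₂) '' fccStacking 1 (Real.sqrt (2 / 3)) ∧
      h + R₀ ≤ p 2 ∧ p 2 ≤ h + 2 * R₀ ∧ p 0 ^ 2 + p 1 ^ 2 ≤ ρ ^ 2 with hP₂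
  have hXpack : ∀ p ∈ X, ∀ q ∈ X, p ≠ q → 1 ≤ dist p q := by
    intro p hp q hq hpq
    obtain ⟨i, -, rfl⟩ := mem_image.1 hp
    obtain ⟨j, -, rfl⟩ := mem_image.1 hq
    exact hx.one_le_dist fun hij => hpq (by rw [hij])
  have hP₁X : P₁ ⊆ X := filter_subset _ _
  have hP₂X : P₂ ⊆ X \ P₁ := filter_subset _ _
  have hXcyl : ∀ p ∈ X, -(2 * R₀) ≤ p 2 ∧ p 2 ≤ h + 2 * R₀ ∧ p 0 ^ 2 + p 1 ^ 2 ≤ ρ ^ 2 := by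
    intro p hp
    obtain ⟨i, -, rfl⟩ := mem_image.1 hp
    exact hcyl i
  have hP₁iff : ∀ p, p ∈ P₁ ↔ (p ∈ (fun q => A₁ q + t₁) '' fccStacking 1 (Real.sqrt (2 / 3)) ∧
      -(2 * R₀) ≤ p 2 ∧ p 2 ≤ -R₀ ∧ p 0 ^ 2 + p 1 ^ 2 ≤ ρ ^ 2) := by
    intro p
    rw [hP₁, mem_filter]
    refine ⟨fun hp => hp.2, fun hp => ⟨?_, hp⟩⟩
    obtain ⟨i, hi⟩ := hslab₁ p hp.1 ⟨hp.2.1, hp.2.2.1, hp.2.2.2⟩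
    exact mem_image.2 ⟨i, mem_univ _, hi⟩
  have hP₂iff : ∀ p, p ∈ P₂ ↔ (p ∈ (fun q => A₂ q + t₂) '' fccStacking 1 (Real.sqrt (2 / 3)) ∧
      h + R₀ ≤ p 2 ∧ p 2 ≤ h + 2 * R₀ ∧ p 0 ^ 2 + p 1 ^ 2 ≤ ρ ^ 2) := by
    intro p
    rw [hP₂, mem_filter]
    refine ⟨fun hp => hp.2, fun hp => ⟨?_, hp⟩⟩
    obtain ⟨i, hi⟩ := hslab₂ p hp.1 ⟨hp.2.1, hp.2.2.1, hp.2.2.2⟩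
    rw [mem_sdiff]
    refine ⟨mem_image.2 ⟨i, mem_univ _, hi⟩, fun hp1 => ?_⟩
    have h1 := ((hP₁iff p).1 hp1).2.2.1
    have h2 := hp.2.1
    linarith
  -- the three inequalities and the two splits
  have hadh' := hadh h hh ρ hρ X P₁ P₂ hXpack hP₁X hP₂X hXcyl hP₁iff hP₂iff
  have hD₁ := hC₁ (-(2 * R₀)) (-R₀) (by ring) ρ hρ P₁ hP₁iff
  have hD₂ := hC₂ (h + R₀) (h + 2 * R₀) (by ring) ρ hρ P₂ hP₂iff
  have hsplit₁ := contactDeficiency_sdiff_split hP₁X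
  have hsplit₂ := contactDeficiency_sdiff_split hP₂X
  have hDX : contactDeficiency X = 6 * (N : ℝ) - (numContacts x : ℝ) :=
    contactDeficiency_image_eq x hxinj
  rw [← hDX]
  have hρ0 : (0 : ℝ) ≤ ρ := by linarith
  have h1h : (0 : ℝ) ≤ (1 + h) * ρ := by positivity
  have ha : C * (1 + h) * ρ ≤ |C| * (1 + h) * ρ := by
    have h1 : 0 ≤ (|C| - C) * ((1 + h) * ρ) := mul_nonneg (by linarith only [le_abs_self C]) h1h
    linarith only [h1]
  have hb : C₁ * ρ ≤ |C₁| * (1 + h) * ρ := by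
    have h1 : 0 ≤ (|C₁| - C₁) * ρ := mul_nonneg (by linarith only [le_abs_self C₁]) hρ0
    have h2 : 0 ≤ |C₁| * h * ρ := by positivity
    linarith only [h1, h2]
  have hc : C₂ * ρ ≤ |C₂| * (1 + h) * ρ := by
    have h1 : 0 ≤ (|C₂| - C₂) * ρ := mul_nonneg (by linarith only [le_abs_self C₂]) hρ0
    have h2 : 0 ≤ |C₂| * h * ρ := by positivity
    linarith only [h1, h2]
  -- the charge is at least one unit of area
  have hπρ : 0 ≤ Real.pi * ρ ^ 2 := by positivity
  have hcharge : (φ₁ + φ₂ - (κ₁ + κ₂) / 2) * Real.pi * ρ ^ 2 ≤ (φ₁ + φ₂ - 1) * Real.pi * ρ ^ 2 := by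
    have h1 : (φ₁ + φ₂ - (κ₁ + κ₂) / 2) * (Real.pi * ρ ^ 2) ≤ (φ₁ + φ₂ - 1) * (Real.pi * ρ ^ 2) :=
      mul_le_mul_of_nonneg_right (by linarith only [hκ₁1, hκ₂1]) hπρ
    simpa only [mul_assoc] using h1
  linarith only [hadh', hD₁, hD₂, hsplit₁, hsplit₂, ha, hb, hc, hcharge]

/-! ### The three instances, modulo `ExactOnly`(C12-55) and `StarPairCoaxial` -/

open scoped Classical in
/-- **`GenericWallFloor` for every NON-CHAIN pair** (a mirror-closed family `𝓕 ∋ A₁` of frames avoiding `A₂·Λ₀`;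
19480-p1's hypothesis form), modulo `ExactOnly`(C12-55) and `StarPairCoaxial`.  Steep slots are chosen inside. -/
theorem genericWallFloorAt_nonChain_of_star
    {s₀ : EuclideanSpace ℝ (Fin 3)} (hs₀ : s₀ ∈ fccSlots)
    (hcert : ExactOnly 0 (fccSlots.filter fun w => 0 < ⟪w, s₀⟫_ℝ)) (hSP : StarPairCoaxial)
    (A₁ : EuclideanSpace ℝ (Fin 3) ≃ₗᵢ[ℝ] EuclideanSpace ℝ (Fin 3)) (t₁ : EuclideanSpace ℝ (Fin 3))
    (A₂ : EuclideanSpace ℝ (Fin 3) ≃ₗᵢ[ℝ] EuclideanSpace ℝ (Fin 3)) (t₂ : EuclideanSpace ℝ (Fin 3))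
    (𝓕 : Set (EuclideanSpace ℝ (Fin 3) ≃ₗᵢ[ℝ] EuclideanSpace ℝ (Fin 3))) (hA₁ : A₁ ∈ 𝓕)
    (havoid : ∀ G ∈ 𝓕, G '' fccStacking 1 (Real.sqrt (2 / 3)) ≠ A₂ '' fccStacking 1 (Real.sqrt (2 / 3)))
    (hclosed : ∀ G ∈ 𝓕, ∀ m : EuclideanSpace ℝ (Fin 3), ‖m‖ = 1 →
      (∀ w ∈ fccSlots, ⟪G w, m⟫_ℝ = 0 ∨ ⟪G w, m⟫_ℝ = Real.sqrt (2 / 3) ∨ ⟪G w, m⟫_ℝ = -Real.sqrt (2 / 3)) →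
      ∀ G' : EuclideanSpace ℝ (Fin 3) ≃ₗᵢ[ℝ] EuclideanSpace ℝ (Fin 3),
        (∀ x, G' x = G x - (2 * ⟪G x, m⟫_ℝ) • m) → G' ∈ 𝓕) :
    GenericWallFloorAt A₁ t₁ A₂ t₂ := by
  obtain ⟨u₁, hu₁, hsteep₁⟩ := exists_steep_slot_up A₁
  obtain ⟨u₂, hu₂, hsteep₂⟩ := exists_steep_slot_down A₂
  exact genericWallFloorAt_of_ledger A₁ t₁ A₂ t₂ hsteep₁ hsteep₂
    (twoSlabAdhesion_stackLedger_local_star hs₀ hcert hSP A₁ t₁ A₂ t₂ hu₁ hsteep₁ hu₂ hsteep₂ 𝓕 hA₁ havoid hclosed)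

open scoped Classical in
/-- **`GenericWallFloor` for every RAY-SEPARATED pair** (steep slots `u₁`/`u₂` whose countable chain-frame sets
`chainFrames e₃ A₁ u₁`, `chainFrames (−e₃) A₂ u₂` are pairwise non-co-axial), modulo `ExactOnly`(C12-55) and
`StarPairCoaxial`. -/
theorem genericWallFloorAt_chain_of_star
    {s₀ : EuclideanSpace ℝ (Fin 3)} (hs₀ : s₀ ∈ fccSlots)
    (hcert : ExactOnly 0 (fccSlots.filter fun w => 0 < ⟪w, s₀⟫_ℝ)) (hSP : StarPairCoaxial)
    (A₁ : EuclideanSpace ℝ (Fin 3) ≃ₗᵢ[ℝ] EuclideanSpace ℝ (Fin 3)) (t₁ : EuclideanSpace ℝ (Fin 3))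
    (A₂ : EuclideanSpace ℝ (Fin 3) ≃ₗᵢ[ℝ] EuclideanSpace ℝ (Fin 3)) (t₂ : EuclideanSpace ℝ (Fin 3))
    {u₁ : EuclideanSpace ℝ (Fin 3)} (hu₁ : u₁ ∈ fccSlots)
    (hsteep₁ : Real.sqrt 2 / 2 ≤ ⟪A₁ u₁, EuclideanSpace.single (2 : Fin 3) (1 : ℝ)⟫_ℝ)
    {u₂ : EuclideanSpace ℝ (Fin 3)} (hu₂ : u₂ ∈ fccSlots)
    (hsteep₂ : ⟪A₂ u₂, EuclideanSpace.single (2 : Fin 3) (1 : ℝ)⟫_ℝ ≤ -(Real.sqrt 2 / 2))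
    (hsep : ∀ F₁ ∈ chainFrames (EuclideanSpace.single (2 : Fin 3) (1 : ℝ)) A₁ u₁,
      ∀ F₂ ∈ chainFrames (-EuclideanSpace.single (2 : Fin 3) (1 : ℝ)) A₂ u₂,
      ¬ ∃ (L : EuclideanSpace ℝ (Fin 3) ≃ₗᵢ[ℝ] EuclideanSpace ℝ (Fin 3))
        (s₁ s₂ : EuclideanSpace ℝ (Fin 3)) (σ σ' : ℤ → ℤ), IsHaggSeq σ ∧ IsHaggSeq σ' ∧
        F₁ '' fccStacking 1 (Real.sqrt (2 / 3)) ⊆ (fun p => L p + s₁) '' barlowStacking 1 (Real.sqrt (2 / 3)) σ ∧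
        F₂ '' fccStacking 1 (Real.sqrt (2 / 3)) ⊆ (fun p => L p + s₂) '' barlowStacking 1 (Real.sqrt (2 / 3)) σ') :
    GenericWallFloorAt A₁ t₁ A₂ t₂ :=
  genericWallFloorAt_of_ledger A₁ t₁ A₂ t₂ hsteep₁ hsteep₂
    (twoSlabAdhesion_stackLedger_local_chain_star hs₀ hcert hSP A₁ t₁ A₂ t₂ hu₁ hsteep₁ hu₂ hsteep₂ hsep)

open scoped Classical in
/-- **`GenericWallFloor` for every chain pair under the WORD CRITERION** (far lattice `(wordFrame A₁ κ)·Λ₀` for a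
reduced model menu word `κ` of length `≥ 2`; steep slots `u₁` in the first mirror plane, `u₂` in the last —
e.g. `Σ9` cells with both steep slots in the composition planes), modulo `ExactOnly`(C12-55) and `StarPairCoaxial`. -/
theorem genericWallFloorAt_word_of_star
    {s₀ : EuclideanSpace ℝ (Fin 3)} (hs₀ : s₀ ∈ fccSlots)
    (hcert : ExactOnly 0 (fccSlots.filter fun w => 0 < ⟪w, s₀⟫_ℝ)) (hSP : StarPairCoaxial)
    (A₁ : EuclideanSpace ℝ (Fin 3) ≃ₗᵢ[ℝ] EuclideanSpace ℝ (Fin 3)) (t₁ : EuclideanSpace ℝ (Fin 3))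
    (A₂ : EuclideanSpace ℝ (Fin 3) ≃ₗᵢ[ℝ] EuclideanSpace ℝ (Fin 3)) (t₂ : EuclideanSpace ℝ (Fin 3))
    {u₁ : EuclideanSpace ℝ (Fin 3)} (hu₁ : u₁ ∈ fccSlots)
    (hsteep₁ : Real.sqrt 2 / 2 ≤ ⟪A₁ u₁, EuclideanSpace.single (2 : Fin 3) (1 : ℝ)⟫_ℝ)
    {u₂ : EuclideanSpace ℝ (Fin 3)} (hu₂ : u₂ ∈ fccSlots)
    (hsteep₂ : ⟪A₂ u₂, EuclideanSpace.single (2 : Fin 3) (1 : ℝ)⟫_ℝ ≤ -(Real.sqrt 2 / 2))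
    (κ : List (EuclideanSpace ℝ (Fin 3)))
    (hκl : ∀ μ ∈ κ, ‖μ‖ = 1 ∧
      ∀ w ∈ fccSlots, ⟪w, μ⟫_ℝ = 0 ∨ ⟪w, μ⟫_ℝ = Real.sqrt (2 / 3) ∨ ⟪w, μ⟫_ℝ = -Real.sqrt (2 / 3))
    (hκc : List.IsChain (fun μ μ' => ⟪μ, μ'⟫_ℝ = 1 / 3 ∨ ⟪μ, μ'⟫_ℝ = -1 / 3) κ) (hκ2 : 2 ≤ κ.length)
    (hA₂ : A₂ '' fccStacking 1 (Real.sqrt (2 / 3)) = (wordFrame A₁ κ) '' fccStacking 1 (Real.sqrt (2 / 3)))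
    (hfirst : ∀ μ, κ.getLast? = some μ → ⟪u₁, μ⟫_ℝ = 0)
    (hlast : ∀ μ, κ.head? = some μ → ⟪A₂ u₂, wordFrame A₁ κ μ⟫_ℝ = 0) :
    GenericWallFloorAt A₁ t₁ A₂ t₂ :=
  genericWallFloorAt_of_ledger A₁ t₁ A₂ t₂ hsteep₁ hsteep₂
    (twoSlabAdhesion_stackLedger_local_word_star hs₀ hcert hSP A₁ t₁ A₂ t₂ hu₁ hsteep₁ hu₂ hsteep₂ κ hκl hκc hκ2
      hA₂ hfirst hlast)

end Summit.Ventures.Crystal3D.Theorems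

end
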